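import Mathlib
import Summits.NavierStokesRegularity.OSWSelfSimilar.HouLuoViscousThetaFloor
import HarnessLib

/-!
# Hou–Luo profile MODEL with MIRROR-TYPE STRETCHING (the homotopy `M_β`): exact ORIGIN LAWS,
# the exponent law `c_l = (2 − β) κ − 2 c_ω`, and why the `θ`-floor does not transplant

HONEST FRAMING (cell ns-blowup GROUP B «PROFILE SEARCH», zone Z8 «Hou–Luo corner analogue WITHOUT the wall»,
gate Z8-0, lead RULING (bp)(3)/(4) 2026-08-26; human rulings D-0035/D-0074/D-0081): **1-D MODEL² (the Hou–Luo
boundary model with the wall's vorticity/temperature feedback replaced by mirror-plane STRETCHING terms by fiat,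
profile-eng-13's homotopy `M_β`), pen-and-paper calculus kernel-checked; not Boussinesq, not Euler, not
Navier–Stokes; «violates: none — MODEL».** Nothing in this file is a statement about Navier–Stokes, and nothing
here asserts that any profile of `M_β` exists.

OBJECT (profile-eng-13 g0, `profile/z8/Z8-0-MIRROR-eng13.md` sha16 7a238f2b8923a113 §2–§3; lead RULING (bp)(3):
the `M_β` kit probe was STRUCK, its exact β-origin laws WELCOMED as a 0-kit kernel sibling of `HouLuoOriginLaws`).
On a mirror line (odd reflection) the first normal jets `W = ω_y|₀`, `Θ = θ_y|₀` of 2-D Boussinesq obey exactly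
`Θ_t + uΘ_x = u_x Θ`, `W_t + uW_x = u_x W + Θ_x`; keeping Hou–Luo's Hilbert closure `u_x = HW` by fiat and
interpolating the stretching coefficient gives the one-parameter family
  `M_β :  W_t + u W_x = β u_x W + Θ_x,   Θ_t + u Θ_x = β u_x Θ,   u_x = HW`
(`β = 0` = Hou–Luo/CKY = the cell's Z3-b′ system; `β = 1` = the mirror jets). In the cell's frozen-`ε` profile
conventions (`HouLuoOriginLaws`: vorticity profile `Ω`, temperature profile `Θ̂` with `P = Θ̂′`, velocity `𝒰` with
`𝒰′ = HΩ`, exponents `c_ω, c_l`, `c_θ = 2c_ω − c_l`, advection knob `a`, viscosity `ε`) the profile system of `M_β` is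
  * the vorticity equation `F₁ ≡ 0` of the tree with stretching knob `b = β` (`HouLuoOriginLaws.F1`, unchanged);
  * the STRETCHED temperature equation `G ≡ c_θ Θ̂ + (c_l ξ + a𝒰) Θ̂′ − ε Θ̂″ − d (HΩ) Θ̂ = 0`, i.e.
    `FTheta c_θ c_l a ε 𝒰 Θ̂ Θ̂′ Θ̂″ ξ = d · HΩ(ξ) · Θ̂(ξ)` with the tree's `HouLuoViscousThetaFloor.FTheta` and a new
    knob `d` (`d = β` on the homotopy);
  * its `ξ`-derivative, the `d`-knob `F₂`: `F₂^d ≡ (2c_ω + (a − d)HΩ) P + (c_lξ + a𝒰) P′ − d (HΩ)′ Θ̂ − εP″ = 0`, i.e.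
    `F2 c_ω c_l a ε HΩ 𝒰 P P′ P″ ξ = d · (HΩ(ξ) P(ξ) + (HΩ)′(ξ) Θ̂(ξ))` with the tree's `HouLuoOriginLaws.F2`
    (`hasDerivAt_FTheta_stretch`: this IS the derivative of `G` when `c_θ = 2c_ω − c_l`).
  No new definition is introduced: the stretching terms are written on the right-hand sides of the tree's residuals.

WHAT IS KERNEL-CHECKED HERE (product rule at `ξ = 0` with `Ω(0) = P(0) = 𝒰(0) = 0`, `𝒰′(0) = HΩ(0) =: H₀`; real algebra):
  * `origin_law0`:          `Θ̂(0) (c_θ − d H₀) = ε Θ̂″(0)`; inviscid dichotomy `Θ̂(0) = 0 ∨ c_θ = d H₀` (`origin_law0_inviscid`);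
  * `origin_law2_stretch`:  `P′(0) (2c_ω + c_l + (2a − d) H₀) = ε P‴(0) + d (HΩ)″(0) Θ̂(0)`  (law 2^d; `d = 0` is the tree's
                            `origin_law2`);
  * law 1 is the tree's `origin_law1` at `b = β` verbatim: `P′(0) = Ω′(0)(c_ω + c_l + (a − β)H₀) − εΩ‴(0)`; at the mirror end
    `a = b = 1` the `H₀`-term CANCELS (`origin_law1_mirror_end`: `P′(0) = Ω′(0)(c_ω + c_l) − εΩ‴(0)`) — the De Gregorio
    cancellation of the vorticity self-amplification `(1 − β)κ` at the stagnation point;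
  * INVISCID LAWS on the branch `Θ̂(0) = 0` with `P′(0) ≠ 0` (`inviscid_mirror_origin_laws`, `a = 1`, `b = d = β ≠ 2`):
      `H₀ = −(2c_ω + c_l)/(2 − β)`,   `P′(0)/Ω′(0) = (c_l + β c_ω)/(2 − β)`,
    and with the origin strain `κ := −H₀` the EXPONENT LAW `c_l = (2 − β) κ − 2 c_ω` (`cl_eq_kappa_beta`; general knobs:
    `c_l = (2a − d) κ − 2c_ω`, `cl_eq_of_kappa_stretch`). `β = 0` returns the tree's `inviscid_origin_laws`
    (`H₀ = −(2c_ω + c_l)/2`, `P′/Ω′ = c_l/2`). In the gauge `c_ω = 1` at the mirror end `β = 1`: `c_l = κ − 2`, so the NS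
    parabolic gauge `c_l = ½` sits at `κ = 5/2` (`cl_eq_half_iff`); the wall-end CHH edge has `κ(0) = (2 + c_l)/2 =
    2.4993520991` — IF `κ` kept that size along the homotopy, `c_l(1) = 0.4993520991` (`chh_edge_arithmetic`, arithmetic only;
    no claim that `κ(1) = κ(0)` or that the family reaches `β = 1`) — the ruling's «c_l ∌ ½ NOT foregone at β = 1».
  * NON-TRANSPLANT OF THE θ-FLOOR (RULING (bp)(4) «Z8-0′ MOOT — CONFIRMED»): the tree's floor `c_θ ≤ 0` (`c_l ≥ 2c_ω`,
    `HouLuoViscousThetaFloor.two_comega_le_cl`) rests on pure transport of `Θ̂`; WITH stretching the same maximum-principle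
    step at a positive maximum / negative minimum `ξ*` of `Θ̂` gives only `c_θ ≤ d · HΩ(ξ*)`
    (`ctheta_le_stretching_of_isLocalMax/Min`, `exists_ctheta_le_stretching`) — SIGN-INDEFINITE (`HΩ = 𝒰′` is the strain at
    the extremum); in particular the NS-type point `(c_ω, c_l) = (1, ½)` is NOT excluded on `M_β`, it merely REQUIRES
    `d · HΩ(ξ*) ≥ 3/2` at some nonzero extremum of `Θ̂` (`nsType_stretching_floor`) — a printable necessary condition.
WHAT IS NOT PROVED HERE: existence, decay or smoothness of any profile; `𝒰′ = HΩ` away from `0`; parity of `HΩ`; the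
dynamical argument selecting the branch `Θ̂(0) = 0`; anything about the 2-D objects of Z8-1. Hypotheses are `HasDerivAt`
facts at a point and the residual identities on `ℝ` (as engines print them on grids), exactly as in `HouLuoOriginLaws`.
No `def`, no `def … : Prop` hypothesis, no `sorry`. PLACEMENT: cell-own MODEL lemma next to `HouLuoOriginLaws` /
`HouLuoViscousThetaFloor` / `HouLuoMirrorPlaneGerm` (profile-eng-14 g6, Z8 engine-B seat, 0 kit). bears on LADDER-NS N5 /
zone Z8 (Z8-0 bookkeeping; SELFSIM-NOGO M7/M8 on the 1-D MODEL) → N1 linear core.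
-/

open Set Filter Topology

namespace Summit.NavierStokesRegularity.OSWSelfSimilar
namespace HouLuoMirrorOriginLaws
open HouLuoOriginLaws (F1 F2 origin_law1)
open HouLuoViscousThetaFloor (FTheta)

/-! ### The stretched temperature equation and its derivative (the `d`-knob `F₂`) -/

/-- **Shifting the stretching term into `c_θ` at a point.** The stretched residual `FTheta c_θ … ξ − d HΩ(ξ) Θ̂(ξ)`
equals the unstretched residual with the POINT-DEPENDENT coefficient `c_θ − d HΩ(ξ)`; this is how the one-point
maximum-principle lemmas of `HouLuoViscousThetaFloor` apply verbatim to the stretched equation. [new here — MODEL] -/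
theorem FTheta_stretch_shift (cθ cl a d ε : ℝ) (H U Θ dΘ ddΘ : ℝ → ℝ) (ξ : ℝ) :
    FTheta (cθ - d * H ξ) cl a ε U Θ dΘ ddΘ ξ = FTheta cθ cl a ε U Θ dΘ ddΘ ξ - d * H ξ * Θ ξ := by
  unfold HouLuoViscousThetaFloor.FTheta
  ring

/-- **`F₂^d` is the `ξ`-derivative of the stretched `Θ`-equation.** If `Θ̂′ = P`, `P′ = dP`, `dP′ = ddP`, `𝒰′ = HΩ`,
`(HΩ)′ = dH` at `ξ` (as `HasDerivAt` facts) and `c_θ = 2c_ω − c_l`, then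
`ξ ↦ FTheta c_θ c_l a ε 𝒰 Θ̂ P dP ξ − d HΩ(ξ) Θ̂(ξ)` has derivative `F2 c_ω c_l a ε HΩ 𝒰 P dP ddP ξ − d (HΩ(ξ)P(ξ) + dH(ξ)Θ̂(ξ))`
at `ξ`: the engines' `d`-knob `F₂ ≡ 0` (`F2 = d(HΩ·P + (HΩ)′·Θ̂)`) is the derivative of `G ≡ 0` (`FTheta = d·HΩ·Θ̂`).
[new here — MODEL; from the tree's `HouLuoViscousThetaFloor.hasDerivAt_FTheta`] -/
theorem hasDerivAt_FTheta_stretch (cω cl a d ε : ℝ) (H dH U Θ P dP ddP : ℝ → ℝ) (ξ : ℝ)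
    (hΘ : HasDerivAt Θ (P ξ) ξ) (hP : HasDerivAt P (dP ξ) ξ) (hdP : HasDerivAt dP (ddP ξ) ξ)
    (hU : HasDerivAt U (H ξ) ξ) (hH : HasDerivAt H (dH ξ) ξ) :
    HasDerivAt (fun x => FTheta (2 * cω - cl) cl a ε U Θ P dP x - d * H x * Θ x)
      (F2 cω cl a ε H U P dP ddP ξ - d * (H ξ * P ξ + dH ξ * Θ ξ)) ξ := by
  have h1 := HouLuoViscousThetaFloor.hasDerivAt_FTheta cω cl a ε H U Θ P dP ddP ξ hΘ hP hdP hU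
  have h2 : HasDerivAt (fun x => d * H x * Θ x) (d * dH ξ * Θ ξ + d * H ξ * P ξ) ξ :=
    (hH.const_mul d).mul hΘ
  have h := h1.sub h2
  refine h.congr_deriv ?_
  ring

/-! ### Origin laws -/

/-- **ORIGIN LAW 0 (the stretched `Θ`-equation read AT the origin).** If `FTheta c_θ c_l a ε 𝒰 Θ̂ Θ̂′ Θ̂″ 0 = d HΩ(0) Θ̂(0)`
and `𝒰(0) = 0`, then `Θ̂(0) (c_θ − d HΩ(0)) = ε Θ̂″(0)`. [new here — MODEL] -/
theorem origin_law0 (cθ cl a d ε : ℝ) (H U Θ dΘ ddΘ : ℝ → ℝ)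
    (hG0 : FTheta cθ cl a ε U Θ dΘ ddΘ 0 = d * H 0 * Θ 0) (hU0 : U 0 = 0) :
    Θ 0 * (cθ - d * H 0) = ε * ddΘ 0 := by
  unfold HouLuoViscousThetaFloor.FTheta at hG0
  rw [hU0] at hG0
  linear_combination hG0

/-- **ORIGIN LAW 0, inviscid dichotomy.** At `ε = 0`: `Θ̂(0) = 0` or `c_θ = d HΩ(0)` (with `c_θ = 2c_ω − c_l` and
`κ = −HΩ(0)`: `c_l = 2c_ω + dκ` on the second branch). The cell's `M_β` analysis works on the first branch
(`Θ̂(0) = 0`: the mirror-line temperature jet at the stagnation point is depleted along the flow — a MODEL argument,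
not proved here). [new here — MODEL] -/
theorem origin_law0_inviscid (cθ cl a d : ℝ) (H U Θ dΘ ddΘ : ℝ → ℝ)
    (hG0 : FTheta cθ cl a 0 U Θ dΘ ddΘ 0 = d * H 0 * Θ 0) (hU0 : U 0 = 0) :
    Θ 0 = 0 ∨ cθ = d * H 0 := by
  have h := origin_law0 cθ cl a d 0 H U Θ dΘ ddΘ hG0 hU0
  rw [zero_mul] at h
  rcases mul_eq_zero.mp h with h0 | h0
  · exact Or.inl h0
  · exact Or.inr (by linarith)

/-- **ORIGIN LAW 2^d (the `d`-knob `F₂` differentiated once at the origin).** If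
`F2 c_ω c_l a ε HΩ 𝒰 P P′ P″ ξ = d (HΩ(ξ) P(ξ) + (HΩ)′(ξ) Θ̂(ξ))` for all `ξ`, `P(0) = 0`, `𝒰(0) = 0`, `𝒰′(0) = HΩ(0)`, and
`Θ̂, P, P′, P″, HΩ, (HΩ)′` are differentiable at `0` with the named values (`Θ̂′(0) = P 0`, `P‴(0) = dddP0`,
`(HΩ)″(0) = ddH0`), then `P′(0) (2c_ω + c_l + (2a − d) HΩ(0)) = ε P‴(0) + d (HΩ)″(0) Θ̂(0)`.
At `d = 0` this is the tree's `HouLuoOriginLaws.origin_law2`; the parity fact `(HΩ)′(0) = 0` is not needed. [new here — MODEL] -/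
theorem origin_law2_stretch (cω cl a d ε : ℝ) (H dH U Θ P dP ddP : ℝ → ℝ) (ddH0 dddP0 : ℝ)
    (hF2d : ∀ ξ, F2 cω cl a ε H U P dP ddP ξ = d * (H ξ * P ξ + dH ξ * Θ ξ))
    (hP0 : P 0 = 0) (hU0 : U 0 = 0)
    (hΘ : HasDerivAt Θ (P 0) 0) (hP : HasDerivAt P (dP 0) 0) (hdP : HasDerivAt dP (ddP 0) 0)
    (hddP : HasDerivAt ddP dddP0 0) (hH : HasDerivAt H (dH 0) 0) (hdH : HasDerivAt dH ddH0 0)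
    (hU : HasDerivAt U (H 0) 0) :
    dP 0 * (2 * cω + cl + (2 * a - d) * H 0) = ε * dddP0 + d * ddH0 * Θ 0 := by
  -- derivative of the left-hand side `F₂` at `0` (as in `HouLuoOriginLaws.origin_law2`)
  have hA : HasDerivAt (fun ξ => 2 * cω + a * H ξ) (a * dH 0) 0 := (hH.const_mul a).const_add (2 * cω)
  have hAP : HasDerivAt (fun ξ => (2 * cω + a * H ξ) * P ξ) (a * dH 0 * P 0 + (2 * cω + a * H 0) * dP 0) 0 :=
    hA.mul hP
  have hB : HasDerivAt (fun ξ => cl * ξ + a * U ξ) (cl * 1 + a * H 0) 0 :=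
    ((hasDerivAt_id' (0 : ℝ)).const_mul cl).add (hU.const_mul a)
  have hBP : HasDerivAt (fun ξ => (cl * ξ + a * U ξ) * dP ξ)
      ((cl * 1 + a * H 0) * dP 0 + (cl * 0 + a * U 0) * ddP 0) 0 := hB.mul hdP
  have hC : HasDerivAt (fun ξ => ε * ddP ξ) (ε * dddP0) 0 := hddP.const_mul ε
  have hf : HasDerivAt (F2 cω cl a ε H U P dP ddP)
      (a * dH 0 * P 0 + (2 * cω + a * H 0) * dP 0 + ((cl * 1 + a * H 0) * dP 0 + (cl * 0 + a * U 0) * ddP 0)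
        - ε * dddP0) 0 := by
    have h := (hAP.add hBP).sub hC
    exact h
  -- derivative of the right-hand side (the stretching terms) at `0`
  have hg : HasDerivAt (fun ξ => d * (H ξ * P ξ + dH ξ * Θ ξ))
      (d * ((dH 0 * P 0 + H 0 * dP 0) + (ddH0 * Θ 0 + dH 0 * P 0))) 0 :=
    ((hH.mul hP).add (hdH.mul hΘ)).const_mul d
  have hfg : F2 cω cl a ε H U P dP ddP = fun ξ => d * (H ξ * P ξ + dH ξ * Θ ξ) := funext hF2d
  rw [hfg] at hf
  have huniq := hf.unique hg
  rw [hP0, hU0] at huniq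
  linear_combination huniq

/-- **ORIGIN LAW 1 AT THE MIRROR END (`a = b = 1`): the De Gregorio cancellation.** For `F₁ ≡ 0` with `a = b = 1` the
tree's `origin_law1` reads `P′(0) = Ω′(0)(c_ω + c_l) − ε Ω‴(0)`: the origin strain `HΩ(0)` has dropped out (its
coefficient is `(a − b) = (1 − β) = 0`) — the mirror deletes the wall model's vorticity feedback at the stagnation point.
[new here — MODEL; instance of `HouLuoOriginLaws.origin_law1`] -/
theorem origin_law1_mirror_end (cω cl ε : ℝ) (H U Om dOm ddOm P : ℝ → ℝ) (h1 dddOm0 dP0 : ℝ)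
    (hF1 : ∀ ξ, F1 cω cl 1 1 ε H U Om dOm ddOm P ξ = 0)
    (hOm0 : Om 0 = 0) (hU0 : U 0 = 0)
    (hOm : HasDerivAt Om (dOm 0) 0) (hdOm : HasDerivAt dOm (ddOm 0) 0) (hddOm : HasDerivAt ddOm dddOm0 0)
    (hP : HasDerivAt P dP0 0) (hH : HasDerivAt H h1 0) (hU : HasDerivAt U (H 0) 0) :
    dP0 = dOm 0 * (cω + cl) - ε * dddOm0 := by
  have h := origin_law1 cω cl 1 1 ε H U Om dOm ddOm P h1 dddOm0 dP0 hF1 hOm0 hU0 hOm hdOm hddOm hP hH hU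
  linear_combination h

/-! ### Scalar algebra of the inviscid laws: `H₀`, the slope ratio, the exponent law -/

/-- **Inviscid law 2^d solved for the origin strain (general knobs).** From `P′(0)(2c_ω + c_l + (2a − d)H₀) = 0` with
`P′(0) ≠ 0` and `2a ≠ d`: `H₀ = −(2c_ω + c_l)/(2a − d)`. [new here — MODEL] -/
theorem hilbert_at_origin_stretch (cω cl a d H0 dP0 : ℝ) (hdP0 : dP0 ≠ 0) (had : 2 * a - d ≠ 0)
    (hlaw2 : dP0 * (2 * cω + cl + (2 * a - d) * H0) = 0) : H0 = -(2 * cω + cl) / (2 * a - d) := by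
  have h : 2 * cω + cl + (2 * a - d) * H0 = 0 := by
    rcases mul_eq_zero.mp hlaw2 with h0 | h0
    · exact absurd h0 hdP0
    · exact h0
  rw [eq_div_iff had]
  linear_combination h

/-- **The exponent law (general knobs).** With `κ := −H₀`, `2c_ω + c_l + (2a − d)H₀ = 0` says
`c_l = (2a − d) κ − 2c_ω`. [new here — MODEL] -/
theorem cl_eq_of_kappa_stretch (cω cl a d H0 κ : ℝ) (hκ : κ = -H0)
    (h : 2 * cω + cl + (2 * a - d) * H0 = 0) : cl = (2 * a - d) * κ - 2 * cω := by
  rw [hκ]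
  linear_combination h

/-- **Slope ratio (general knobs).** With `H₀ = −(2c_ω + c_l)/(2a − d)`, law 1 at `ε = 0`
(`P′(0) = Ω′(0)(c_ω + c_l + (a − b)H₀)`) reads `P′(0) = [((a + b − d) c_l + (2b − d) c_ω)/(2a − d)] · Ω′(0)`.
[new here — MODEL] -/
theorem slope_ratio_stretch (cω cl a b d H0 dOm0 dP0 : ℝ) (had : 2 * a - d ≠ 0)
    (hH0 : H0 = -(2 * cω + cl) / (2 * a - d))
    (hlaw1 : dP0 = dOm0 * (cω + cl + (a - b) * H0)) :
    dP0 = ((a + b - d) * cl + (2 * b - d) * cω) / (2 * a - d) * dOm0 := by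
  have hmul : H0 * (2 * a - d) = -(2 * cω + cl) := (eq_div_iff had).mp hH0
  rw [hlaw1, div_mul_eq_mul_div, eq_div_iff had]
  linear_combination (dOm0 * (a - b)) * hmul

/-- **`M_β`: the origin strain.** On the homotopy (`a = 1`, `d = β ≠ 2`), from `P′(0)(2c_ω + c_l + (2 − β)H₀) = 0` and
`P′(0) ≠ 0`: `H₀ = −(2c_ω + c_l)/(2 − β)` (`β = 0`: the tree's `−(2c_ω + c_l)/2`). [new here — MODEL] -/
theorem hilbert_at_origin_beta (cω cl β H0 dP0 : ℝ) (hdP0 : dP0 ≠ 0) (hβ : β ≠ 2)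
    (hlaw2 : dP0 * (2 * cω + cl + (2 - β) * H0) = 0) : H0 = -(2 * cω + cl) / (2 - β) := by
  have h : 2 * cω + cl + (2 - β) * H0 = 0 := by
    rcases mul_eq_zero.mp hlaw2 with h0 | h0
    · exact absurd h0 hdP0
    · exact h0
  have hne : (2 - β) ≠ 0 := sub_ne_zero.mpr (Ne.symm hβ)
  rw [eq_div_iff hne]
  linear_combination h

/-- **`M_β`: the slope ratio.** With `H₀ = −(2c_ω + c_l)/(2 − β)` and law 1 at `(a, b, ε) = (1, β, 0)`
(`P′(0) = Ω′(0)(c_ω + c_l + (1 − β)H₀)`): `P′(0) = [(c_l + β c_ω)/(2 − β)] · Ω′(0)` (`β = 0`: the tree's `c_l/2`).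
[new here — MODEL] -/
theorem slope_ratio_beta (cω cl β H0 dOm0 dP0 : ℝ) (hβ : β ≠ 2)
    (hH0 : H0 = -(2 * cω + cl) / (2 - β)) (hlaw1 : dP0 = dOm0 * (cω + cl + (1 - β) * H0)) :
    dP0 = (cl + β * cω) / (2 - β) * dOm0 := by
  have hne : (2 - β) ≠ 0 := sub_ne_zero.mpr (Ne.symm hβ)
  rw [hlaw1, hH0]
  field_simp
  ring

/-- **`M_β`: THE EXPONENT LAW `c_l = (2 − β) κ − 2 c_ω`** (`κ := −H₀` = origin strain in self-similar units). In the gauge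
`c_ω = 1`: `c_l(β) = (2 − β) κ(β) − 2` — at the wall end `κ(0) = (2 + c_l)/2`, at the mirror end `c_l(1) = κ(1) − 2`.
[new here — MODEL] -/
theorem cl_eq_kappa_beta (cω cl β H0 κ : ℝ) (hβ : β ≠ 2) (hκ : κ = -H0)
    (hH0 : H0 = -(2 * cω + cl) / (2 - β)) : cl = (2 - β) * κ - 2 * cω := by
  have hne : (2 - β) ≠ 0 := sub_ne_zero.mpr (Ne.symm hβ)
  rw [hκ, hH0]
  field_simp
  ring

/-- **The NS parabolic gauge on the homotopy.** Under the exponent law `c_l = (2 − β)κ − 2c_ω`: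
`c_l = ½ ⇔ (2 − β) κ = 2c_ω + ½`; in the gauge `c_ω = 1` at the mirror end `β = 1` this is `κ = 5/2`
(`cl_eq_half_iff_mirror_end`). [new here — MODEL; arithmetic] -/
theorem cl_eq_half_iff (cω cl β κ : ℝ) (h : cl = (2 - β) * κ - 2 * cω) :
    cl = 1 / 2 ↔ (2 - β) * κ = 2 * cω + 1 / 2 := by
  constructor
  · intro h'
    linarith
  · intro h'
    linarith

/-- **Mirror end, gauge `c_ω = 1`:** `c_l = κ − 2`, so `c_l = ½ ⇔ κ = 5/2`. [new here — MODEL; arithmetic] -/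
theorem cl_eq_half_iff_mirror_end (cl κ : ℝ) (h : cl = (2 - 1) * κ - 2 * 1) : cl = 1 / 2 ↔ κ = 5 / 2 := by
  constructor
  · intro h'
    linarith
  · intro h'
    linarith

/-- **CHH-edge arithmetic (numbers only; no dynamical claim).** In the gauge `c_ω = 1` the wall-end law gives
`κ(0) = (2 + c_l)/2`; at the Chen–Hou–Huang edge of the cell's certified family `c_l = 2.9987041982` this is
`κ(0) = 2.4993520991` (both Z3 engines print `HΩ(0) = −2.4993520991`). IF the origin strain kept that size at the mirror
end, the exponent law would give `c_l(1) = κ − 2 = 0.4993520991`, within `7·10⁻⁴` of the NS gauge `½` — the content of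
RULING (bp)'s remark «c_l ∌ ½ NOT foregone at β = 1». Nothing here asserts `κ(1) = κ(0)` or that the family reaches
`β = 1` (eng-13's two-sided pre-statement PS-Mβ: fold/delocalisation at some `β* < 1` vs survival). [new here — MODEL] -/
theorem chh_edge_arithmetic :
    ((2 : ℝ) + 29987041982 / 10 ^ 10) / 2 = 24993520991 / 10 ^ 10 ∧
    (24993520991 / 10 ^ 10 : ℝ) - 2 = 4993520991 / 10 ^ 10 ∧
    |(4993520991 / 10 ^ 10 : ℝ) - 1 / 2| < 7 / 10 ^ 4 := by
  refine ⟨by norm_num, by norm_num, ?_⟩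
  rw [abs_sub_lt_iff]
  constructor <;> norm_num

/-! ### The inviscid `M_β` origin laws, function form -/

/-- **INVISCID `M_β` ORIGIN LAWS, function form.** For the inviscid (`ε = 0`) profile system of `M_β` — `F₁ ≡ 0` with
`(a, b) = (1, β)` and the `d`-knob `F₂` with `(a, d) = (1, β)`, i.e. `F2 … ξ = β (HΩ·P + (HΩ)′·Θ̂)(ξ)` on `ℝ` — with odd
`Ω, P` (`Ω(0) = P(0) = 0`), `𝒰(0) = 0`, `𝒰′(0) = HΩ(0)`, on the branch `Θ̂(0) = 0`, with the needed derivatives at `0`,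
`P′(0) ≠ 0` and `β ≠ 2`:
  `HΩ(0) = −(2c_ω + c_l)/(2 − β)`  and  `P′(0) = [(c_l + β c_ω)/(2 − β)] Ω′(0)`.
(`β = 0` is the tree's `HouLuoOriginLaws.inviscid_origin_laws`; the third-derivative slots are inherited bookkeeping,
multiplied by `ε = 0`.) [new here — MODEL] -/
theorem inviscid_mirror_origin_laws (cω cl β : ℝ) (H dH U Om dOm ddOm Θ P dP ddP : ℝ → ℝ)
    (ddH0 dddOm0 dddP0 : ℝ) (hβ : β ≠ 2)
    (hF1 : ∀ ξ, F1 cω cl 1 β 0 H U Om dOm ddOm P ξ = 0)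
    (hF2d : ∀ ξ, F2 cω cl 1 0 H U P dP ddP ξ = β * (H ξ * P ξ + dH ξ * Θ ξ))
    (hOm0 : Om 0 = 0) (hP0 : P 0 = 0) (hU0 : U 0 = 0) (hΘ0 : Θ 0 = 0)
    (hOm : HasDerivAt Om (dOm 0) 0) (hdOm : HasDerivAt dOm (ddOm 0) 0) (hddOm : HasDerivAt ddOm dddOm0 0)
    (hΘ : HasDerivAt Θ (P 0) 0) (hP : HasDerivAt P (dP 0) 0) (hdP : HasDerivAt dP (ddP 0) 0)
    (hddP : HasDerivAt ddP dddP0 0) (hH : HasDerivAt H (dH 0) 0) (hdH : HasDerivAt dH ddH0 0)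
    (hU : HasDerivAt U (H 0) 0) (hdP0 : dP 0 ≠ 0) :
    H 0 = -(2 * cω + cl) / (2 - β) ∧ dP 0 = (cl + β * cω) / (2 - β) * dOm 0 := by
  have l2 := origin_law2_stretch cω cl 1 β 0 H dH U Θ P dP ddP ddH0 dddP0 hF2d hP0 hU0 hΘ hP hdP hddP hH hdH hU
  have l1 := origin_law1 cω cl 1 β 0 H U Om dOm ddOm P (dH 0) dddOm0 (dP 0) hF1 hOm0 hU0 hOm hdOm hddOm hP hH hU
  rw [hΘ0] at l2
  have hH0 : H 0 = -(2 * cω + cl) / (2 - β) :=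
    hilbert_at_origin_beta cω cl β (H 0) (dP 0) hdP0 hβ (by linear_combination l2)
  refine ⟨hH0, slope_ratio_beta cω cl β (H 0) (dOm 0) (dP 0) hβ hH0 ?_⟩
  linear_combination l1

/-- **INVISCID `M_β` EXPONENT LAW, function form.** Under the hypotheses of `inviscid_mirror_origin_laws`, with
`κ := −HΩ(0)`: `c_l = (2 − β) κ − 2 c_ω`. [new here — MODEL] -/
theorem inviscid_mirror_exponent_law (cω cl β : ℝ) (H dH U Om dOm ddOm Θ P dP ddP : ℝ → ℝ)
    (ddH0 dddOm0 dddP0 : ℝ) (hβ : β ≠ 2)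
    (hF1 : ∀ ξ, F1 cω cl 1 β 0 H U Om dOm ddOm P ξ = 0)
    (hF2d : ∀ ξ, F2 cω cl 1 0 H U P dP ddP ξ = β * (H ξ * P ξ + dH ξ * Θ ξ))
    (hOm0 : Om 0 = 0) (hP0 : P 0 = 0) (hU0 : U 0 = 0) (hΘ0 : Θ 0 = 0)
    (hOm : HasDerivAt Om (dOm 0) 0) (hdOm : HasDerivAt dOm (ddOm 0) 0) (hddOm : HasDerivAt ddOm dddOm0 0)
    (hΘ : HasDerivAt Θ (P 0) 0) (hP : HasDerivAt P (dP 0) 0) (hdP : HasDerivAt dP (ddP 0) 0)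
    (hddP : HasDerivAt ddP dddP0 0) (hH : HasDerivAt H (dH 0) 0) (hdH : HasDerivAt dH ddH0 0)
    (hU : HasDerivAt U (H 0) 0) (hdP0 : dP 0 ≠ 0) :
    cl = (2 - β) * (-H 0) - 2 * cω := by
  have h := (inviscid_mirror_origin_laws cω cl β H dH U Om dOm ddOm Θ P dP ddP ddH0 dddOm0 dddP0 hβ hF1 hF2d hOm0 hP0
    hU0 hΘ0 hOm hdOm hddOm hΘ hP hdP hddP hH hdH hU hdP0).1
  exact cl_eq_kappa_beta cω cl β (H 0) (-H 0) hβ rfl h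

/-! ### The θ-maximum-principle floor does NOT transplant to stretched systems -/

/-- **At a positive local maximum of `Θ̂` with stretching: `c_θ ≤ d · HΩ(ξ*)`.** If the stretched `Θ`-equation holds at
`ξ*` (`FTheta c_θ c_l a ε 𝒰 Θ̂ Θ̂′ Θ̂″ ξ* = d HΩ(ξ*) Θ̂(ξ*)`), `ε ≥ 0`, `Θ̂` is differentiable near `ξ*` with derivative
`Θ̂′`, `Θ̂′` has derivative `Θ̂″(ξ*)` at `ξ*`, and `ξ*` is a local maximum with `Θ̂(ξ*) > 0`, then
`(c_θ − d HΩ(ξ*)) Θ̂(ξ*) = ε Θ̂″(ξ*) ≤ 0`, hence `c_θ ≤ d HΩ(ξ*)`. At `d = 0` this is the tree's `c_θ ≤ 0`; for `d ≠ 0`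
the bound is SIGN-INDEFINITE (`HΩ = 𝒰′` is the strain at the extremum) — RULING (bp)(4): the Z8-0′ floor does not
transplant. [new here — MODEL; corollary of `HouLuoViscousThetaFloor.ctheta_nonpos_of_isLocalMax`] -/
theorem ctheta_le_stretching_of_isLocalMax (cθ cl a d ε : ℝ) (H U Θ dΘ ddΘ : ℝ → ℝ) (ξ : ℝ) (hε : 0 ≤ ε)
    (hG : FTheta cθ cl a ε U Θ dΘ ddΘ ξ = d * H ξ * Θ ξ) (hmax : IsLocalMax Θ ξ) (hpos : 0 < Θ ξ)
    (hΘ : ∀ᶠ x in 𝓝 ξ, HasDerivAt Θ (dΘ x) x) (hdΘ : HasDerivAt dΘ (ddΘ ξ) ξ) : cθ ≤ d * H ξ := by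
  have hF : FTheta (cθ - d * H ξ) cl a ε U Θ dΘ ddΘ ξ = 0 := by
    rw [FTheta_stretch_shift, hG, sub_self]
  have h := HouLuoViscousThetaFloor.ctheta_nonpos_of_isLocalMax (cθ - d * H ξ) cl a ε U Θ dΘ ddΘ ξ hε hF hmax
    hpos hΘ hdΘ
  linarith

/-- **At a negative local minimum of `Θ̂` with stretching: `c_θ ≤ d · HΩ(ξ*)`** (the equation is linear in `Θ̂`).
[new here — MODEL; corollary of `HouLuoViscousThetaFloor.ctheta_nonpos_of_isLocalMin`] -/
theorem ctheta_le_stretching_of_isLocalMin (cθ cl a d ε : ℝ) (H U Θ dΘ ddΘ : ℝ → ℝ) (ξ : ℝ) (hε : 0 ≤ ε)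
    (hG : FTheta cθ cl a ε U Θ dΘ ddΘ ξ = d * H ξ * Θ ξ) (hmin : IsLocalMin Θ ξ) (hneg : Θ ξ < 0)
    (hΘ : ∀ᶠ x in 𝓝 ξ, HasDerivAt Θ (dΘ x) x) (hdΘ : HasDerivAt dΘ (ddΘ ξ) ξ) : cθ ≤ d * H ξ := by
  have hF : FTheta (cθ - d * H ξ) cl a ε U Θ dΘ ddΘ ξ = 0 := by
    rw [FTheta_stretch_shift, hG, sub_self]
  have h := HouLuoViscousThetaFloor.ctheta_nonpos_of_isLocalMin (cθ - d * H ξ) cl a ε U Θ dΘ ddΘ ξ hε hF hmin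
    hneg hΘ hdΘ
  linarith

/-- **Decaying nontrivial stretched profiles: the floor becomes `c_θ ≤ d · HΩ(ξ*)` at some nonzero extremum.** If `Θ̂`
is `C²` on `ℝ` (`Θ̂′ = dΘ`, `Θ̂″ = ddΘ` everywhere), solves the stretched `Θ`-equation `FTheta … ξ = d HΩ(ξ) Θ̂(ξ)` on `ℝ`
with `ε ≥ 0` and SOME drift `𝒰` and strain `HΩ`, tends to `0` at `±∞` and is not identically zero, then there is a
point `ξ*` with `Θ̂(ξ*) ≠ 0`, `ξ*` a local extremum of `Θ̂`, and `c_θ ≤ d HΩ(ξ*)`. (At `d = 0`: `c_θ ≤ 0`, the contrapositive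
of the tree's `theta_eq_zero_of_ctheta_pos`.) [new here — MODEL] -/
theorem exists_ctheta_le_stretching (cθ cl a d ε : ℝ) (H U Θ dΘ ddΘ : ℝ → ℝ) (hε : 0 ≤ ε)
    (hG : ∀ ξ, FTheta cθ cl a ε U Θ dΘ ddΘ ξ = d * H ξ * Θ ξ)
    (hΘ : ∀ x, HasDerivAt Θ (dΘ x) x) (hdΘ : ∀ x, HasDerivAt dΘ (ddΘ x) x)
    (h0 : Tendsto Θ (cocompact ℝ) (𝓝 0)) (hne : Θ ≠ 0) :
    ∃ ξ, Θ ξ ≠ 0 ∧ IsLocalExtr Θ ξ ∧ cθ ≤ d * H ξ := by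
  have hcont : Continuous Θ := continuous_iff_continuousAt.2 fun x => (hΘ x).continuousAt
  have hx : ∃ x, Θ x ≠ 0 := by
    by_contra h
    apply hne
    funext x
    by_contra hx
    exact h ⟨x, hx⟩
  obtain ⟨x₀, hx₀⟩ := hx
  rcases lt_or_gt_of_ne hx₀ with hneg | hpos
  · obtain ⟨x, hmin, hxneg⟩ := HouLuoViscousThetaFloor.exists_isLocalMin_neg_of_tendsto_zero hcont h0 hneg
    exact ⟨x, hxneg.ne, hmin.isExtr, ctheta_le_stretching_of_isLocalMin cθ cl a d ε H U Θ dΘ ddΘ x hε (hG x) hmin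
      hxneg (Filter.Eventually.of_forall hΘ) (hdΘ x)⟩
  · have hpos' : 0 < Θ x₀ := hpos
    obtain ⟨x, hmax, hxpos⟩ := HouLuoViscousThetaFloor.exists_isLocalMax_pos_of_tendsto_zero hcont h0 hpos'
    exact ⟨x, hxpos.ne', hmax.isExtr, ctheta_le_stretching_of_isLocalMax cθ cl a d ε H U Θ dΘ ddΘ x hε (hG x) hmax
      hxpos (Filter.Eventually.of_forall hΘ) (hdΘ x)⟩

/-- **In the Hou–Luo scaling (`c_θ = 2c_ω − c_l`): the stretched floor `c_l ≥ 2c_ω − d · HΩ(ξ*)`** at some nonzero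
extremum `ξ*` of a nontrivial decaying `C²` temperature profile — sign-indefinite, unlike the unstretched `c_l ≥ 2c_ω`
(`HouLuoViscousThetaFloor.two_comega_le_cl`). [new here — MODEL] -/
theorem cl_ge_two_comega_sub_stretching (cω cl a d ε : ℝ) (H U Θ dΘ ddΘ : ℝ → ℝ) (hε : 0 ≤ ε)
    (hG : ∀ ξ, FTheta (2 * cω - cl) cl a ε U Θ dΘ ddΘ ξ = d * H ξ * Θ ξ)
    (hΘ : ∀ x, HasDerivAt Θ (dΘ x) x) (hdΘ : ∀ x, HasDerivAt dΘ (ddΘ x) x)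
    (h0 : Tendsto Θ (cocompact ℝ) (𝓝 0)) (hne : Θ ≠ 0) :
    ∃ ξ, Θ ξ ≠ 0 ∧ 2 * cω - d * H ξ ≤ cl := by
  obtain ⟨ξ, hξ, -, hle⟩ := exists_ctheta_le_stretching (2 * cω - cl) cl a d ε H U Θ dΘ ddΘ hε hG hΘ hdΘ h0 hne
  exact ⟨ξ, hξ, by linarith⟩

/-- **The NS-type point is NOT excluded on `M_β`; it REQUIRES strain.** At the NS-compatible exponents `(c_ω, c_l) = (1, ½)`
(the tree's `nsTypeLine_empty` kills this point on the UNSTRETCHED sheet), a nontrivial decaying `C²` temperature profile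
of the stretched equation forces `d · HΩ(ξ*) ≥ 3/2` at some nonzero extremum `ξ*` of `Θ̂` — a printable NECESSARY condition
for any viscous-stage run of a stretched 1-D caricature, not an exclusion. [new here — MODEL] -/
theorem nsType_stretching_floor (a d ε : ℝ) (H U Θ dΘ ddΘ : ℝ → ℝ) (hε : 0 ≤ ε)
    (hG : ∀ ξ, FTheta (2 * 1 - 1 / 2) (1 / 2) a ε U Θ dΘ ddΘ ξ = d * H ξ * Θ ξ)
    (hΘ : ∀ x, HasDerivAt Θ (dΘ x) x) (hdΘ : ∀ x, HasDerivAt dΘ (ddΘ x) x)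
    (h0 : Tendsto Θ (cocompact ℝ) (𝓝 0)) (hne : Θ ≠ 0) :
    ∃ ξ, Θ ξ ≠ 0 ∧ 3 / 2 ≤ d * H ξ := by
  obtain ⟨ξ, hξ, hle⟩ := cl_ge_two_comega_sub_stretching 1 (1 / 2) a d ε H U Θ dΘ ddΘ hε hG hΘ hdΘ h0 hne
  exact ⟨ξ, hξ, by linarith⟩

end HouLuoMirrorOriginLaws
end Summit.NavierStokesRegularity.OSWSelfSimilar
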